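import Literature.MathematicalPhysics.StatisticalMechanics.MonomerDimerZeros
import Literature.Analysis.Complex.VitaliIdentityTransport
import HarnessLib

/-!
# Analyticity in the mass of thermodynamic limits of the NJL system: the Vitali–Montel step of
# Salmhofer–Seiler's Theorem 3.8 (CMP 139 (1991), Thm. 3.8, Cor. 3.9; Gruber–Kunz 1971)

Companion of `MonomerDimerZeros` (SS91 Thm. 3.6, (3.28), Cor. 3.9 in finite volume).  Printed:

* **Theorem 3.8** (p. 407). "Let `⟨ ⟩_Λ` be the expectation value of the NJL model on `Λ ⊂ ℤ^ν` and
  `L` a finite multiindex. (1) For all `m ∈ 𝒲`, the thermodynamic limit `⟨σ^L⟩ = lim_{Λ→∞} ⟨σ^L⟩_Λ`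
  (3.31) exists if `Λ → ∞` in the sense of Van Hove. (2) `⟨σ^L⟩` is an analytic function of `m` on
  `𝒲`.  *Proof.* By Remark 3.2, the NJL system on `Λ` is an ordinary monomer-dimer system on a graph
  `Γ(Λ)` with vertex set `V(Γ(Λ)) = Λ × {1,…,N}`.  The proof of the statement for these systems is
  contained in [20], see also [28]."  Here `𝒲 = ℂ ∖ 2i[-√(2νN), √(2νN)]` (after (3.28)) and [20] =
  Gruber–Kunz, whose argument is: convergence of the cluster expansion for large `|m|`, zero-freeness
  (Heilmann–Lieb) and uniform bounds on the zero-free region, and **Vitali's theorem**.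
* **Corollary 3.9.** "Let `m ∈ ℝ`. A phase transition can occur in a NJL model only if `m = 0`. For
  `m ≠ 0`, all correlation functions are analytic in `m`."

WHAT IS PROVED HERE (theorems only; no definition of a named fact).  With the finite-volume NJL
correlation functions at complex mass of `MonomerDimerZeros` (`ComplexSpin.njlExpectC`, on the tori
`(ℤ/Lℤ)^ν` used throughout the tree's Salmhofer–Seiler series; a multi-index `d` of finite support in
`ℤ^ν` is read on each torus through `Torus.proj`, as in `ComplexSpinThermodynamicLimit`):

* `ComplexSpin.njlMassRegion ν = {m | Re m ≠ 0 ∨ |m| > √(2ν)} = ℂ ∖ i[-√(2ν), √(2ν)]`, the zero-free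
  region of `MonomerDimerZeros` (it contains the printed `𝒲` for `N ≥ 1`,
  `printedRegion_subset_njlMassRegion`): open and connected (`isOpen_njlMassRegion`,
  `isPreconnected_njlMassRegion`);
* `differentiableOn_njlCorrelation`, `njlCorrelation_locally_bounded`: every finite-volume
  correlation `m ↦ ⟨σ^d⟩_Λ(m)` is holomorphic on the region and the family (over ALL volumes) is
  locally bounded there — the two Vitali hypotheses, from Thm. 3.6/(3.28) and the Heilmann–Lieb
  ratio bounds;
* **`exists_subseq_tendstoLocallyUniformlyOn_njlCorrelation`** (Montel): along every sequence of
  volumes some subsequence of `⟨σ^d⟩_{Λ_n}(·)` converges locally uniformly on the region to a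
  function HOLOMORPHIC in `m` — Thm. 3.8 (2) for subsequential limits, unconditionally;
* **`exists_tendstoLocallyUniformlyOn_njlCorrelation_of_tendsto_on`** (Vitali): if `⟨σ^d⟩_{Λ_n}(m)`
  converges on a subset of the region accumulating at one of its points — e.g. for all real masses
  in some interval `[a, b]`, `0 < a < b` (`…_of_tendsto_real`) — then it converges locally uniformly
  on the WHOLE region to a holomorphic function: the thermodynamic limit is unique and analytic in
  `m` on `ℂ ∖ i[-√(2ν), √(2ν)] ⊇ 𝒲` as soon as it exists for large (or any interval of) real masses.
  This is exactly the step "[20] + Vitali" of the printed proof; the remaining input of Thm. 3.8 (1),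
  convergence for large real `m` along van Hove sequences (the Gruber–Kunz/Mayer expansion of the
  dilute dimer gas), is NOT formalised here.

* **`exists_subseq_forall_tendstoLocallyUniformlyOn_njlCorrelation`** (Thm. 3.8 (2) with Thm. 3.18 (2)):
  along every sequence of volumes ONE subsequence makes ALL correlation functions `⟨σ^d⟩_{Λ_n}(·)`
  converge locally uniformly on the region to functions holomorphic in `m` (diagonal extraction at
  countably many real masses, as in `ComplexSpinThermodynamicLimit`, then Vitali for each `d`):
  subsequential thermodynamic-limit states of the NJL system are analytic in the mass on `𝒲`.
* **Remark 3.4 (1)** ("strongly coupled QED is an NJL system"): at `N = 1` the `U(N)` bond weight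
  (2.23) and the NJL weight coincide to order `N` (`bondWeight_uN_one_eq_njl`), hence all brackets and
  expectations of `β = 0` lattice QED are those of the `N = 1` NJL system (`expect_uN_one_eq_njl`;
  with `StrongCouplingBosonisation.fermiExpect_spinObs` this is the gauge-level statement), and
  `qed_partitionFunction_ne_zero`, `qed_abs_expect_monomial_le` follow.
* **Remark 3.10 in finite volume** (the hopping-parameter expansion, `K = 1/(2m)`): for every volume
  the function `K ↦ ⟨σ^d⟩_Λ(1/2K)` (`njlHopping`, value at `K = 0` its limit) is holomorphic on the disc
  `|K| < (2√(2ν))⁻¹ ⊇ {|K| < (2√(2νN))⁻¹}` (`differentiableOn_njlHopping`, `analyticOnNhd_njlHopping`)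
  with the volume-independent majorant `(2|K|)^{|d|}` (`norm_njlHopping_le`): the hopping expansion of
  every finite-volume correlation converges on the printed disc, uniformly in `Λ`; the printed
  infinite-volume statement additionally needs Thm. 3.8 (1).

Honest framing: statements about the `β = 0` NJL complex spin system on finite tori and limits of its
correlation functions; nothing about `β > 0`, the continuum, a mass gap or the summit's `QCD` conjunct.

## References

* M. Salmhofer, E. Seiler, Commun. Math. Phys. 139 (1991) 395–432: Thm. 3.8, Cor. 3.9, Remark 3.10
  (p. 407). [SalmhoferSeiler1991]
* C. Gruber, H. Kunz, Commun. Math. Phys. 22 (1971) 133–161 (analyticity and thermodynamic limit of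
  polymer systems in the zero-free region; SS91's [20]). [GruberKunz1971]
* O. J. Heilmann, E. H. Lieb, Commun. Math. Phys. 25 (1972) 190–232, Thm. 4.6, Lemma 4.8 (the
  Vitali-type continuation lemma used there). [HeilmannLieb1972]
-/

noncomputable section

open MvPolynomial Finset Filter Metric Set Topology

namespace Literature.MathematicalPhysics.StatisticalMechanics

namespace ComplexSpin

open Literature.Probability.LatticeModels (TorusSite Site)
open Literature.Probability.LatticeModels

variable {ν : ℕ}

/-! ### The zero-free mass region `ℂ ∖ i[-√(2ν), √(2ν)]` -/

/-- The mass region `{Re m ≠ 0} ∪ {|m| > √(2ν)} = ℂ ∖ i[-√(2ν), √(2ν)]` on which the finite-volume NJL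
partition functions have no zeros (Thm. 3.6 with (3.28)); it contains the printed
`𝒲 = ℂ ∖ 2i[-√(2νN), √(2νN)]`. [cite: SalmhoferSeiler1991, Thm. 3.6 and (3.28)] -/
def njlMassRegion (ν : ℕ) : Set ℂ :=
  {m | m.re ≠ 0 ∨ Real.sqrt (2 * ν) < ‖m‖}

/-- The mass region is open. [cite: SalmhoferSeiler1991, Thm. 3.8] -/
theorem isOpen_njlMassRegion : IsOpen (njlMassRegion ν) := by
  have h1 : IsOpen {m : ℂ | m.re ≠ 0} := isOpen_ne_fun Complex.continuous_re continuous_const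
  have h2 : IsOpen {m : ℂ | Real.sqrt (2 * ν) < ‖m‖} := isOpen_lt continuous_const continuous_norm
  exact h1.union h2

/-- A point of the purely imaginary axis has norm `|Im m|`. [folklore] -/
private theorem norm_eq_abs_im_of_re_eq_zero {m : ℂ} (h : m.re = 0) : ‖m‖ = |m.im| := by
  apply le_antisymm
  · have := Complex.norm_le_abs_re_add_abs_im m
    rw [h, abs_zero, zero_add] at this
    exact this
  · exact Complex.abs_im_le_norm m

/-- The mass region as a union of four open half planes. [folklore] -/
private theorem njlMassRegion_eq_union :
    njlMassRegion ν =
      (({m : ℂ | 0 < m.re} ∪ {m : ℂ | Real.sqrt (2 * ν) < m.im}) ∪ {m : ℂ | m.re < 0}) ∪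
        {m : ℂ | m.im < -Real.sqrt (2 * ν)} := by
  ext m
  simp only [njlMassRegion, Set.mem_setOf_eq, Set.mem_union]
  constructor
  · rintro (h | h)
    · rcases lt_or_gt_of_ne h with h' | h'
      · exact Or.inl (Or.inr h')
      · exact Or.inl (Or.inl (Or.inl h'))
    · by_cases hre : m.re = 0
      · rw [norm_eq_abs_im_of_re_eq_zero hre] at h
        rcases lt_abs.1 h with h' | h'
        · exact Or.inl (Or.inl (Or.inr h'))
        · exact Or.inr (by linarith)
      · rcases lt_or_gt_of_ne hre with h' | h'
        · exact Or.inl (Or.inr h')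
        · exact Or.inl (Or.inl (Or.inl h'))
  · rintro (((h | h) | h) | h)
    · exact Or.inl h.ne'
    · exact Or.inr (h.trans_le ((le_abs_self _).trans (Complex.abs_im_le_norm m)))
    · exact Or.inl h.ne
    · refine Or.inr (lt_of_lt_of_le ?_ (Complex.abs_im_le_norm m))
      have : Real.sqrt (2 * ν) < -m.im := by linarith
      exact this.trans_le (neg_le_abs _)

/-- **The mass region `ℂ ∖ i[-√(2ν), √(2ν)]` is connected.** [cite: SalmhoferSeiler1991, Thm. 3.8] -/
theorem isPreconnected_njlMassRegion : IsPreconnected (njlMassRegion ν) := by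
  set s := Real.sqrt (2 * ν) with hs
  have hA : IsPreconnected {m : ℂ | 0 < m.re} :=
    (convex_halfSpace_gt Complex.reLm.isLinear 0).isPreconnected
  have hB : IsPreconnected {m : ℂ | m.re < 0} :=
    (convex_halfSpace_lt Complex.reLm.isLinear 0).isPreconnected
  have hC : IsPreconnected {m : ℂ | s < m.im} :=
    (convex_halfSpace_gt Complex.imLm.isLinear s).isPreconnected
  have hD : IsPreconnected {m : ℂ | m.im < -s} :=
    (convex_halfSpace_lt Complex.imLm.isLinear (-s)).isPreconnected
  have hs0 : 0 ≤ s := Real.sqrt_nonneg _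
  have h1 : IsPreconnected ({m : ℂ | 0 < m.re} ∪ {m : ℂ | s < m.im}) := by
    refine IsPreconnected.union ⟨1, s + 1⟩ ?_ ?_ hA hC
    · show (0 : ℝ) < 1; norm_num
    · show s < s + 1; linarith
  have h2 : IsPreconnected (({m : ℂ | 0 < m.re} ∪ {m : ℂ | s < m.im}) ∪ {m : ℂ | m.re < 0}) := by
    refine IsPreconnected.union ⟨-1, s + 1⟩ ?_ ?_ h1 hB
    · right; show s < s + 1; linarith
    · show (-1 : ℝ) < 0; norm_num
  have h3 : IsPreconnected ((({m : ℂ | 0 < m.re} ∪ {m : ℂ | s < m.im}) ∪ {m : ℂ | m.re < 0}) ∪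
      {m : ℂ | m.im < -s}) := by
    refine IsPreconnected.union ⟨1, -(s + 1)⟩ ?_ ?_ h2 hD
    · left; left; show (0 : ℝ) < 1; norm_num
    · show -(s + 1) < -s; linarith
  rw [njlMassRegion_eq_union]
  exact h3

/-- Points of the mass region are non-zero. [folklore] -/
private theorem ne_zero_of_mem_njlMassRegion {m : ℂ} (hm : m ∈ njlMassRegion ν) : m ≠ 0 := by
  rintro rfl
  rcases hm with h | h
  · exact h Complex.zero_re
  · rw [norm_zero] at h
    exact absurd h (not_lt.2 (Real.sqrt_nonneg _))

/-- The printed region `𝒲 = ℂ ∖ 2i[-√(2νN), √(2νN)]` lies in the mass region (`N ≥ 1`).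
[cite: SalmhoferSeiler1991, (3.28)] -/
theorem printedRegion_subset_njlMassRegion {N : ℕ} (hN : 1 ≤ N) :
    {m : ℂ | ¬ (m.re = 0 ∧ |m.im| ≤ 2 * Real.sqrt (2 * ν * N))} ⊆ njlMassRegion ν := by
  intro m hm
  rcases not_and_or.1 hm with h1 | h2
  · exact Or.inl h1
  · right
    have h2' : 2 * Real.sqrt (2 * ν * N) < |m.im| := not_le.1 h2
    have hN' : (1 : ℝ) ≤ N := by exact_mod_cast hN
    have hν : (0 : ℝ) ≤ ν := Nat.cast_nonneg ν
    calc Real.sqrt (2 * ν) ≤ Real.sqrt (2 * ν * N) := Real.sqrt_le_sqrt (by nlinarith)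
      _ ≤ 2 * Real.sqrt (2 * ν * N) := by linarith [Real.sqrt_nonneg (2 * ν * N)]
      _ < |m.im| := h2'
      _ ≤ ‖m‖ := Complex.abs_im_le_norm m

/-- `Z_Λ(m) ≠ 0` on the mass region, in every volume. [cite: SalmhoferSeiler1991, Thm. 3.6 and (3.28)] -/
theorem njlPartitionFunctionC_ne_zero_of_mem_njlMassRegion {L : ℕ} [NeZero L] (N : ℕ) {m : ℂ}
    (hm : m ∈ njlMassRegion ν) : njlPartitionFunctionC (ν := ν) (L := L) N m ≠ 0 := by
  rcases hm with h | h
  · exact njlPartitionFunctionC_ne_zero_of_re_ne_zero N h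
  · exact njlPartitionFunctionC_ne_zero_of_sqrt_le_norm N
      (ne_zero_of_mem_njlMassRegion (Or.inr h)) h.le

/-! ### Finite-volume correlation functions as functions of the complex mass -/

/-- The finite-volume NJL correlation function `m ↦ ⟨σ^d⟩_Λ(m)` of the monomial with multi-index
`d` (finite support in `ℤ^ν`, read on the torus `Λ = (ℤ/Lℤ)^ν` through the projection), as a
function of the complex mass. [cite: SalmhoferSeiler1991, (3.30)–(3.31)] -/
def njlCorrelation (N L : ℕ) [NeZero L] (d : Site ν →₀ ℕ) (m : ℂ) : ℂ :=
  njlExpectC N m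
    (monomial (Finsupp.mapDomain (Torus.proj L) d) (1 : ℂ) : FieldAlg ν L)

/-- Transporting a multi-index to the torus does not change its total degree. [folklore] -/
private theorem degree_mapDomain {α β : Type*} (f : α → β) (d : α →₀ ℕ) :
    (Finsupp.mapDomain f d).degree = d.degree := by
  classical
  have h1 : (Finsupp.mapDomain f d).degree = (Finsupp.mapDomain f d).sum fun _ e => e := rfl
  have h2 : d.degree = d.sum fun _ e => e := rfl
  rw [h1, h2]
  exact Finsupp.sum_mapDomain_index (fun _ => rfl) (fun _ _ _ => rfl)

/-- **Holomorphy in finite volume** (Cor. 3.9): `m ↦ ⟨σ^d⟩_Λ(m)` is holomorphic on the mass region.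
[cite: SalmhoferSeiler1991, Thm. 3.8 (2) and Cor. 3.9] -/
theorem differentiableOn_njlCorrelation (N L : ℕ) [NeZero L] (d : Site ν →₀ ℕ) :
    DifferentiableOn ℂ (njlCorrelation N L d) (njlMassRegion ν) :=
  (differentiableOn_njlExpectC N _).mono fun _ hm =>
    njlPartitionFunctionC_ne_zero_of_mem_njlMassRegion N hm

/-- **Local boundedness, uniformly in the volume**: around every point of the mass region there is a
ball on which all `⟨σ^d⟩_Λ(m)`, for ALL volumes `Λ`, are bounded by one constant (from the
Heilmann–Lieb ratio bounds `(2|Re m|)^{-|d|}`, `|m|^{-|d|}`). [cite: HeilmannLieb1972, Lemma 4.7 and Lemma 4.4][cite: SalmhoferSeiler1992Erratum, (5)] -/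
theorem njlCorrelation_locally_bounded {N : ℕ} (hN : 1 ≤ N) (d : Site ν →₀ ℕ) :
    ∀ a ∈ njlMassRegion ν, ∃ M : ℝ, ∃ r > 0, ∀ (L : ℕ) (_ : NeZero L),
      ∀ z ∈ ball a r ∩ njlMassRegion ν, ‖njlCorrelation N L d z‖ ≤ M := by
  intro a ha
  by_cases hre : a.re ≠ 0
  · -- off the imaginary axis: `|Re z| ≥ |Re a|/2` on the ball of radius `|Re a|/2`
    refine ⟨(|a.re|)⁻¹ ^ d.degree, |a.re| / 2, by positivity, fun L _ z hz => ?_⟩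
    have hza : ‖z - a‖ < |a.re| / 2 := mem_ball_iff_norm.1 hz.1
    have hre_z : |a.re| / 2 ≤ |z.re| := by
      have h1 : |z.re - a.re| ≤ ‖z - a‖ := by
        simpa using Complex.abs_re_le_norm (z - a)
      have := abs_sub_abs_le_abs_sub a.re z.re
      rw [abs_sub_comm] at this
      linarith
    have hzre : z.re ≠ 0 := by
      intro h0
      rw [h0, abs_zero] at hre_z
      have : 0 < |a.re| := abs_pos.2 hre
      linarith
    have hb := norm_njlExpectC_monomial_le_of_re (ν := ν) (L := L) hN hzre
      (Finsupp.mapDomain (Torus.proj L) d)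
    rw [degree_mapDomain] at hb
    refine hb.trans (pow_le_pow_left₀ (by positivity) ?_ _)
    rw [inv_le_inv₀ (by positivity) (abs_pos.2 hre)]
    linarith
  · -- on the far imaginary axis: `|z| ≥ (|a| + √(2ν))/2 ≥ √(2ν)` on a small ball
    rw [not_ne_iff] at hre
    have ha' : Real.sqrt (2 * ν) < ‖a‖ := by
      rcases ha with h | h
      · exact absurd hre h
      · exact h
    set s := Real.sqrt (2 * ν) with hs
    have hs0 : 0 ≤ s := Real.sqrt_nonneg _
    refine ⟨((‖a‖ + s) / 2)⁻¹ ^ d.degree, (‖a‖ - s) / 2, by linarith, fun L _ z hz => ?_⟩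
    have hza : ‖z - a‖ < (‖a‖ - s) / 2 := mem_ball_iff_norm.1 hz.1
    have hz_norm : (‖a‖ + s) / 2 ≤ ‖z‖ := by
      have := norm_sub_norm_le a z
      rw [← norm_neg (a - z), neg_sub] at this
      linarith
    have hpos : 0 < (‖a‖ + s) / 2 := by linarith
    have hz0 : z ≠ 0 := by
      intro h0; rw [h0, norm_zero] at hz_norm; linarith
    have hb := norm_njlExpectC_monomial_le_of_norm (ν := ν) (L := L) hN hz0 (by linarith)
      (Finsupp.mapDomain (Torus.proj L) d)
    rw [degree_mapDomain] at hb
    refine hb.trans (pow_le_pow_left₀ (by positivity) ?_ _)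
    rw [inv_le_inv₀ (hpos.trans_le hz_norm) hpos]
    exact hz_norm

/-! ### Theorem 3.8: Montel and Vitali -/

/-- **Theorem 3.8 (2) for subsequential limits (Montel).**  For the NJL system (`N ≥ 1`), every
multi-index `d` and every sequence of volumes `Λ_n = (ℤ/L_nℤ)^ν`, some subsequence of the
finite-volume correlation functions `m ↦ ⟨σ^d⟩_{Λ_n}(m)` converges locally uniformly on
`ℂ ∖ i[-√(2ν), √(2ν)]` to a function holomorphic in the mass, together with all `m`-derivatives.
[cite: SalmhoferSeiler1991, Thm. 3.8 (2)][cite: GruberKunz1971, §3] -/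
theorem exists_subseq_tendstoLocallyUniformlyOn_njlCorrelation {N : ℕ} (hN : 1 ≤ N)
    (d : Site ν →₀ ℕ) (Ls : ℕ → ℕ) [∀ n, NeZero (Ls n)] :
    ∃ f : ℂ → ℂ, ∃ φ : ℕ → ℕ, StrictMono φ ∧ DifferentiableOn ℂ f (njlMassRegion ν) ∧
      TendstoLocallyUniformlyOn (fun n => njlCorrelation N (Ls (φ n)) d) f atTop
        (njlMassRegion ν) ∧
      TendstoLocallyUniformlyOn (fun n => deriv (njlCorrelation N (Ls (φ n)) d)) (deriv f) atTop
        (njlMassRegion ν) := by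
  refine Complex.exists_strictMono_tendstoLocallyUniformlyOn_deriv isOpen_njlMassRegion
    (fun n => differentiableOn_njlCorrelation N (Ls n) d) fun a ha => ?_
  obtain ⟨M, r, hr, hM⟩ := njlCorrelation_locally_bounded hN d a ha
  exact ⟨M, r, hr, fun n z hz => hM (Ls n) inferInstance z hz⟩

/-- **Theorem 3.8 (the Vitali step).**  For the NJL system (`N ≥ 1`), a multi-index `d` and a
sequence of volumes `Λ_n`: if the finite-volume correlations `⟨σ^d⟩_{Λ_n}(m)` converge at every mass
of a set `S ⊆ ℂ ∖ i[-√(2ν), √(2ν)]` accumulating at a point of that region, then they converge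
locally uniformly on the WHOLE region `ℂ ∖ i[-√(2ν), √(2ν)] ⊇ 𝒲` to a function holomorphic in `m`:
the thermodynamic limit exists on all of `𝒲` and is analytic there (Gruber–Kunz [20]: zero-freeness
+ uniform bounds + Vitali). [cite: SalmhoferSeiler1991, Thm. 3.8][cite: GruberKunz1971, §3] -/
theorem exists_tendstoLocallyUniformlyOn_njlCorrelation_of_tendsto_on {N : ℕ} (hN : 1 ≤ N)
    (d : Site ν →₀ ℕ) (Ls : ℕ → ℕ) [∀ n, NeZero (Ls n)] {z₀ : ℂ} (hz₀ : z₀ ∈ njlMassRegion ν)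
    {S : Set ℂ} (hS : ∃ᶠ z in 𝓝[≠] z₀, z ∈ S)
    (hconv : ∀ m ∈ S, ∃ c : ℂ, Tendsto (fun n => njlCorrelation N (Ls n) d m) atTop (𝓝 c)) :
    ∃ f : ℂ → ℂ, DifferentiableOn ℂ f (njlMassRegion ν) ∧
      TendstoLocallyUniformlyOn (fun n => njlCorrelation N (Ls n) d) f atTop (njlMassRegion ν) := by
  refine Literature.Analysis.Complex.exists_tendstoLocallyUniformlyOn_of_tendsto_on
    isOpen_njlMassRegion isPreconnected_njlMassRegion
    (fun n => differentiableOn_njlCorrelation N (Ls n) d) (fun a ha => ?_) hz₀ hS hconv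
  obtain ⟨M, r, hr, hM⟩ := njlCorrelation_locally_bounded hN d a ha
  exact ⟨M, r, hr, fun n z hz => hM (Ls n) inferInstance z hz⟩

/-- **Theorem 3.8 from convergence at real masses.**  If, for the NJL system (`N ≥ 1`) and a sequence
of volumes, the correlation `⟨σ^d⟩_{Λ_n}(m)` converges for every REAL mass `m` in some interval
`[a, b]`, `0 < a < b` (e.g. for all large masses, where the dilute dimer gas has a convergent
cluster expansion), then it converges for every complex mass in `ℂ ∖ i[-√(2ν), √(2ν)] ⊇ 𝒲`, locally
uniformly, to a function analytic in `m` — Thm. 3.8 (1)–(2) and Cor. 3.9 ("for `m ≠ 0`, all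
correlation functions are analytic in `m`") modulo the large-mass convergence.
[cite: SalmhoferSeiler1991, Thm. 3.8 and Cor. 3.9][cite: GruberKunz1971, §3] -/
theorem exists_tendstoLocallyUniformlyOn_njlCorrelation_of_tendsto_real {N : ℕ} (hN : 1 ≤ N)
    (d : Site ν →₀ ℕ) (Ls : ℕ → ℕ) [∀ n, NeZero (Ls n)] {a b : ℝ} (ha : 0 < a) (hab : a < b)
    (hconv : ∀ t ∈ Icc a b, ∃ c : ℂ,
      Tendsto (fun n => njlCorrelation N (Ls n) d (t : ℂ)) atTop (𝓝 c)) :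
    ∃ f : ℂ → ℂ, DifferentiableOn ℂ f (njlMassRegion ν) ∧
      TendstoLocallyUniformlyOn (fun n => njlCorrelation N (Ls n) d) f atTop (njlMassRegion ν) := by
  have hz₀ : ((a : ℝ) : ℂ) ∈ njlMassRegion ν := Or.inl (by rw [Complex.ofReal_re]; exact ha.ne')
  refine exists_tendstoLocallyUniformlyOn_njlCorrelation_of_tendsto_on hN d Ls hz₀
    (Literature.Analysis.Complex.frequently_nhdsNE_ofReal_mem_image_Icc ⟨le_rfl, hab⟩) ?_
  rintro m ⟨t, ht, rfl⟩
  exact hconv t ht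

/-- **Corollary 3.9 (real masses), limit form.**  Under the hypothesis of
`exists_tendstoLocallyUniformlyOn_njlCorrelation_of_tendsto_real`, the thermodynamic limit of
`⟨σ^d⟩_Λ(m)` exists for EVERY real `m ≠ 0` (both signs) and is the restriction of a function
holomorphic on `ℂ ∖ i[-√(2ν), √(2ν)]` — in particular real-analytic in `m` on `ℝ ∖ {0}`: "a phase
transition can occur in a NJL model only if `m = 0`". [cite: SalmhoferSeiler1991, Cor. 3.9] -/
theorem tendsto_njlCorrelation_real_of_tendsto_real {N : ℕ} (hN : 1 ≤ N)
    (d : Site ν →₀ ℕ) (Ls : ℕ → ℕ) [∀ n, NeZero (Ls n)] {a b : ℝ} (ha : 0 < a) (hab : a < b)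
    (hconv : ∀ t ∈ Icc a b, ∃ c : ℂ,
      Tendsto (fun n => njlCorrelation N (Ls n) d (t : ℂ)) atTop (𝓝 c)) :
    ∃ f : ℂ → ℂ, DifferentiableOn ℂ f (njlMassRegion ν) ∧
      ∀ m : ℝ, m ≠ 0 → Tendsto (fun n => njlCorrelation N (Ls n) d (m : ℂ)) atTop (𝓝 (f m)) := by
  obtain ⟨f, hf, hlim⟩ :=
    exists_tendstoLocallyUniformlyOn_njlCorrelation_of_tendsto_real hN d Ls ha hab hconv
  refine ⟨f, hf, fun m hm => hlim.tendsto_at (Or.inl ?_)⟩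
  rwa [Complex.ofReal_re]

/-! ### Remark 3.4 (1): strongly coupled QED (`N = 1`) is an NJL system -/

section QED

variable {L : ℕ}

/-- At `N = 1` the `U(N)` bond weight (2.23), `B(t) = ∑_k (N-k)!N^{2k}/(N!k!) t^k = 1 + t`, and the NJL
bond weight `e^{Nt} = e^t` agree to the relevant order `N = 1` (Remark 3.2): "strongly coupled QED is an
NJL system". [cite: SalmhoferSeiler1991, Remark 3.4(1)] -/
theorem bondWeight_uN_one_eq_njl (x y : TorusSite ν L) :
    bondWeight 1 (uNBondCoeff 1) x y = bondWeight 1 (njlBondCoeff 1) x y := by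
  unfold bondWeight
  refine Finset.sum_congr rfl fun k hk => ?_
  have hk' : k < 2 := Finset.mem_range.1 hk
  interval_cases k <;> simp [uNBondCoeff, njlBondCoeff]

variable [NeZero L]

/-- **Remark 3.4 (1)**: the complex spin system of `β = 0` lattice QED (`U(1)`, `g₄ = 0`) IS the NJL
system with `N = 1` — identical Boltzmann polynomials. [cite: SalmhoferSeiler1991, Remark 3.4(1)] -/
theorem boltzmann_uN_one_eq_njl (m : ℝ) :
    boltzmann (ν := ν) (L := L) 1 m (uNBondCoeff 1) = boltzmann 1 m (njlBondCoeff 1) := by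
  unfold boltzmann
  simp_rw [bondWeight_uN_one_eq_njl]

/-- Remark 3.4 (1) for the unnormalised expectations `[Φ]_Λ`. [cite: SalmhoferSeiler1991, Remark 3.4(1)] -/
theorem bracket_uN_one_eq_njl (m : ℝ) (Φ : MvPolynomial (TorusSite ν L) ℝ) :
    bracket 1 m (uNBondCoeff 1) Φ = bracket 1 m (njlBondCoeff 1) Φ := by
  unfold bracket
  rw [boltzmann_uN_one_eq_njl]

/-- Remark 3.4 (1) for the partition functions. [cite: SalmhoferSeiler1991, Remark 3.4(1)] -/
theorem partitionFunction_uN_one_eq_njl (m : ℝ) :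
    partitionFunction (ν := ν) (L := L) 1 m (uNBondCoeff 1) =
      partitionFunction (ν := ν) (L := L) 1 m (njlBondCoeff 1) := by
  unfold partitionFunction
  rw [bracket_uN_one_eq_njl]

/-- Remark 3.4 (1) for the expectations `⟨Φ⟩_Λ`: every correlation function of `β = 0` QED equals the
corresponding NJL (`N = 1`) correlation function. [cite: SalmhoferSeiler1991, Remark 3.4(1)] -/
theorem expect_uN_one_eq_njl (m : ℝ) (Φ : MvPolynomial (TorusSite ν L) ℝ) :
    expect 1 m (uNBondCoeff 1) Φ = expect 1 m (njlBondCoeff 1) Φ := by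
  unfold expect
  rw [bracket_uN_one_eq_njl, partitionFunction_uN_one_eq_njl]

/-- **Cor. 3.9 for `β = 0` QED, finite volume**: the partition function of strongly coupled lattice QED
does not vanish at any real mass `m ≠ 0`, in every volume (Thm. 3.6 via Remark 3.4(1)).
[cite: SalmhoferSeiler1991, Remark 3.4(1) and Cor. 3.9] -/
theorem qed_partitionFunction_ne_zero {m : ℝ} (hm : m ≠ 0) :
    partitionFunction (ν := ν) (L := L) 1 m (uNBondCoeff 1) ≠ 0 := by
  rw [partitionFunction_uN_one_eq_njl]
  exact njl_partitionFunction_ne_zero 1 hm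

/-- The uniform bound for `β = 0` QED: `|⟨σ^l⟩_Λ| ≤ (2|m|)^{-|l|}` for real `m ≠ 0`, every volume.
[cite: SalmhoferSeiler1991, Remark 3.4(1)][cite: SalmhoferSeiler1992Erratum, (5)] -/
theorem qed_abs_expect_monomial_le {m : ℝ} (hm : m ≠ 0) (l : TorusSite ν L →₀ ℕ) :
    |expect 1 m (uNBondCoeff 1) (monomial l 1)| ≤ (2 * |m|)⁻¹ ^ l.degree := by
  rw [expect_uN_one_eq_njl]
  exact njl_abs_expect_monomial_le le_rfl hm l

end QED

/-! ### Remark 3.10 in finite volume: the hopping-parameter expansion -/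

/-- The correlation function `⟨σ^d⟩_Λ` as a function of the hopping parameter `K = 1/(2m)`, with its
limiting value (`1` for the empty monomial, `0` otherwise) at `K = 0` (`m = ∞`). [cite: SalmhoferSeiler1991, Remark 3.10] -/
def njlHopping (N L : ℕ) [NeZero L] (d : Site ν →₀ ℕ) : ℂ → ℂ :=
  Function.update (fun K : ℂ => njlCorrelation N L d (2 * K)⁻¹) 0 (if d = 0 then 1 else 0)

/-- `|1/(2K)| = (2|K|)⁻¹`. [folklore] -/
private theorem norm_inv_two_mul (K : ℂ) : ‖(2 * K : ℂ)⁻¹‖ = (2 * ‖K‖)⁻¹ := by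
  simp

/-- Inside the hopping disc the mass `1/(2K)` lies strictly beyond the zeros: `√(2ν) < |1/(2K)|`.
[cite: SalmhoferSeiler1991, (3.28) and Remark 3.10] -/
private theorem sqrt_lt_norm_inv_of_lt {K : ℂ} (hK0 : K ≠ 0)
    (hK : ‖K‖ < (2 * Real.sqrt (2 * ν))⁻¹) : Real.sqrt (2 * ν) < ‖(2 * K : ℂ)⁻¹‖ := by
  rw [norm_inv_two_mul]
  have hKpos : 0 < ‖K‖ := norm_pos_iff.2 hK0
  rcases (Real.sqrt_nonneg (2 * ν)).eq_or_lt with hs | hs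
  · rw [← hs]; positivity
  · rw [lt_inv_comm₀ hs (by positivity)]
    have h2 : (2 * Real.sqrt (2 * ν))⁻¹ = (Real.sqrt (2 * ν))⁻¹ / 2 := by
      rw [mul_inv]; ring
    rw [h2] at hK
    linarith

/-- Inside the hopping disc the mass `1/(2K)` lies beyond the zeros: `√(2ν) ≤ |1/(2K)|`. [cite: SalmhoferSeiler1991, (3.28) and Remark 3.10] -/
private theorem sqrt_le_norm_inv_of_lt {K : ℂ} (hK0 : K ≠ 0)
    (hK : ‖K‖ < (2 * Real.sqrt (2 * ν))⁻¹) : Real.sqrt (2 * ν) ≤ ‖(2 * K : ℂ)⁻¹‖ :=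
  (sqrt_lt_norm_inv_of_lt hK0 hK).le

/-- **The volume-independent majorant** of the hopping-parameter function: for `0 < |K| < (2√(2ν))⁻¹`,
`|⟨σ^d⟩_Λ(1/2K)| ≤ (2|K|)^{|d|}`, for every volume (`N ≥ 1`). [cite: SalmhoferSeiler1991, Remark 3.10][cite: HeilmannLieb1972, Lemma 4.4] -/
theorem norm_njlCorrelation_hopping_le {N : ℕ} (hN : 1 ≤ N) (L : ℕ) [NeZero L] (d : Site ν →₀ ℕ)
    {K : ℂ} (hK0 : K ≠ 0) (hK : ‖K‖ < (2 * Real.sqrt (2 * ν))⁻¹) :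
    ‖njlCorrelation N L d (2 * K)⁻¹‖ ≤ (2 * ‖K‖) ^ d.degree := by
  have hm0 : (2 * K : ℂ)⁻¹ ≠ 0 := inv_ne_zero (mul_ne_zero two_ne_zero hK0)
  have h := norm_njlExpectC_monomial_le_of_norm (ν := ν) (L := L) hN hm0
    (sqrt_le_norm_inv_of_lt hK0 hK) (Finsupp.mapDomain (Torus.proj L) d)
  rw [degree_mapDomain, norm_inv_two_mul, inv_inv] at h
  exact h

/-- Off `K = 0` the hopping function is the correlation at mass `1/(2K)`. [folklore] -/
private theorem njlHopping_of_ne_zero (N L : ℕ) [NeZero L] (d : Site ν →₀ ℕ) {K : ℂ} (hK : K ≠ 0) :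
    njlHopping N L d K = njlCorrelation N L d (2 * K)⁻¹ := by
  simp [njlHopping, Function.update_of_ne hK]

/-- The empty monomial has expectation `1` wherever `Z_Λ ≠ 0`. [folklore] -/
private theorem njlCorrelation_zero_of_ne_zero (N L : ℕ) [NeZero L] {m : ℂ}
    (hZ : njlPartitionFunctionC (ν := ν) (L := L) N m ≠ 0) :
    njlCorrelation (ν := ν) N L 0 m = 1 := by
  unfold njlCorrelation njlExpectC
  rw [Finsupp.mapDomain_zero, monomial_zero', C_1]
  exact div_self hZ

/-- **Remark 3.10 in finite volume (the hopping-parameter expansion).**  For the NJL system (`N ≥ 1`),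
every multi-index `d` and EVERY volume `Λ`, the correlation function as a function of the hopping
parameter `K = 1/(2m)` extends holomorphically to the disc `|K| < (2√(2ν))⁻¹` (which contains the
printed disc of radius `(2√(2νN))⁻¹`) — so its Taylor series at `K = 0`, the hopping-parameter
expansion, has radius of convergence at least `(2√(2ν))⁻¹` uniformly in the volume, with the
volume-independent majorant `(2|K|)^{|d|}` (`norm_njlCorrelation_hopping_le`); "the expansion … does
not converge for all `m > 0` due to the zeros of the finite-volume partition functions on the
imaginary axis". [cite: SalmhoferSeiler1991, Remark 3.10] -/
theorem differentiableOn_njlHopping {N : ℕ} (hN : 1 ≤ N) (L : ℕ) [NeZero L] (d : Site ν →₀ ℕ) :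
    DifferentiableOn ℂ (njlHopping N L d) (ball 0 (2 * Real.sqrt (2 * ν))⁻¹) := by
  set r : ℝ := (2 * Real.sqrt (2 * ν))⁻¹ with hr
  by_cases hr0 : r ≤ 0
  · rw [Metric.ball_eq_empty.2 hr0]
    exact differentiableOn_empty
  have hrpos : 0 < r := lt_of_not_ge hr0
  -- holomorphy off the origin: composition with `K ↦ 1/(2K)`, which lands beyond the zeros
  have hoff : DifferentiableOn ℂ (njlHopping N L d) (ball 0 r \ {0}) := by
    have hsub : ∀ K ∈ ball (0 : ℂ) r \ {0}, K ≠ 0 ∧ ‖K‖ < r := fun K hK =>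
      ⟨hK.2, by simpa using hK.1⟩
    have hcomp : DifferentiableOn ℂ (fun K : ℂ => njlCorrelation N L d (2 * K)⁻¹) (ball 0 r \ {0}) := by
      refine (differentiableOn_njlCorrelation N L d).comp
        ((DifferentiableOn.inv ((differentiableOn_const 2).mul differentiableOn_id) fun K hK =>
          mul_ne_zero two_ne_zero (hsub K hK).1)) fun K hK => ?_
      exact Or.inr (sqrt_lt_norm_inv_of_lt (hsub K hK).1 (hsub K hK).2)
    exact hcomp.congr fun K hK => njlHopping_of_ne_zero N L d (hsub K hK).1
  -- continuity at the origin from the majorant `(2|K|)^{|d|}`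
  have hcont : ContinuousAt (njlHopping N L d) 0 := by
    rw [ContinuousAt, Metric.tendsto_nhds]
    intro ε hε
    have hδ : 0 < min r (min (1 / 2) (ε / 2)) := by positivity
    filter_upwards [Metric.ball_mem_nhds (0 : ℂ) hδ] with K hK
    rw [Metric.mem_ball, dist_zero_right] at hK
    have hKr : ‖K‖ < r := lt_of_lt_of_le hK (min_le_left _ _)
    have hK12 : ‖K‖ < 1 / 2 := lt_of_lt_of_le hK ((min_le_right _ _).trans (min_le_left _ _))
    have hKε : ‖K‖ < ε / 2 := lt_of_lt_of_le hK ((min_le_right _ _).trans (min_le_right _ _))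
    rw [dist_eq_norm]
    by_cases hK0 : K = 0
    · subst hK0; simpa using hε
    rw [njlHopping_of_ne_zero N L d hK0]
    have hval : njlHopping N L d 0 = if d = 0 then 1 else 0 := by simp [njlHopping]
    rw [hval]
    by_cases hd : d = 0
    · subst hd
      have hZ : njlPartitionFunctionC (ν := ν) (L := L) N (2 * K)⁻¹ ≠ 0 :=
        njlPartitionFunctionC_ne_zero_of_sqrt_le_norm N (inv_ne_zero (mul_ne_zero two_ne_zero hK0))
          (sqrt_le_norm_inv_of_lt hK0 hKr)
      rw [njlCorrelation_zero_of_ne_zero N L hZ, if_pos rfl, sub_self, norm_zero]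
      exact hε
    · rw [if_neg hd, sub_zero]
      have hdeg : 1 ≤ d.degree := by
        rw [Nat.one_le_iff_ne_zero]
        exact fun h => hd ((Finsupp.degree_eq_zero_iff d).1 h)
      have h2K : 2 * ‖K‖ ≤ 1 := by linarith
      calc ‖njlCorrelation N L d (2 * K)⁻¹‖ ≤ (2 * ‖K‖) ^ d.degree :=
            norm_njlCorrelation_hopping_le hN L d hK0 hKr
        _ ≤ (2 * ‖K‖) ^ 1 := pow_le_pow_of_le_one (by positivity) h2K hdeg
        _ < ε := by rw [pow_one]; linarith
  exact (Complex.differentiableOn_compl_singleton_and_continuousAt_iff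
    (Metric.ball_mem_nhds 0 hrpos)).1 ⟨hoff, hcont⟩

/-- **Remark 3.10, analytic form**: the hopping-parameter function is analytic on the disc
`|K| < (2√(2ν))⁻¹` in every volume; its power series at `0` is the hopping-parameter expansion.
[cite: SalmhoferSeiler1991, Remark 3.10] -/
theorem analyticOnNhd_njlHopping {N : ℕ} (hN : 1 ≤ N) (L : ℕ) [NeZero L] (d : Site ν →₀ ℕ) :
    AnalyticOnNhd ℂ (njlHopping N L d) (ball 0 (2 * Real.sqrt (2 * ν))⁻¹) :=
  (differentiableOn_njlHopping hN L d).analyticOnNhd isOpen_ball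

/-- The majorant on the whole disc, including the centre: `|njlHopping K| ≤ max 1 ((2|K|)^{|d|})`-free form —
for `d ≠ 0`, `|njlHopping N L d K| ≤ (2|K|)^{|d|}` for all `|K| < (2√(2ν))⁻¹`, uniformly in the volume
(Cauchy's estimate then bounds every hopping-expansion coefficient uniformly in `Λ`).
[cite: SalmhoferSeiler1991, Remark 3.10] -/
theorem norm_njlHopping_le {N : ℕ} (hN : 1 ≤ N) (L : ℕ) [NeZero L] {d : Site ν →₀ ℕ} (hd : d ≠ 0)
    {K : ℂ} (hK : ‖K‖ < (2 * Real.sqrt (2 * ν))⁻¹) :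
    ‖njlHopping N L d K‖ ≤ (2 * ‖K‖) ^ d.degree := by
  by_cases hK0 : K = 0
  · subst hK0
    simp [njlHopping, hd]
  · rw [njlHopping_of_ne_zero N L d hK0]
    exact norm_njlCorrelation_hopping_le hN L d hK0 hK

/-! ### One subsequence for all correlation functions (Thm. 3.8 (2) with Thm. 3.18 (2)) -/

/-- The real masses `u_k = 1 + 1/(k+2) → 1` used to pin down the limits. [folklore] -/
private def pinMass (k : ℕ) : ℂ := ((1 + 1 / ((k : ℝ) + 2) : ℝ) : ℂ)

/-- The real part of the pinning mass. [folklore] -/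
private theorem pinMass_re (k : ℕ) : (pinMass k).re = 1 + 1 / ((k : ℝ) + 2) := by
  unfold pinMass
  exact Complex.ofReal_re _

/-- The pinning masses have real part `≥ 1`. [folklore] -/
private theorem one_le_pinMass_re (k : ℕ) : 1 ≤ (pinMass k).re := by
  rw [pinMass_re]
  have h : (0 : ℝ) ≤ 1 / ((k : ℝ) + 2) := by positivity
  linarith

/-- The pinning masses differ from their limit `1`. [folklore] -/
private theorem pinMass_ne_one (k : ℕ) : pinMass k ≠ 1 := by
  intro h
  have := congrArg Complex.re h
  rw [pinMass_re, Complex.one_re] at this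
  have : (0 : ℝ) < 1 / ((k : ℝ) + 2) := by positivity
  linarith

/-- The pinning masses tend to `1`. [folklore] -/
private theorem tendsto_pinMass : Tendsto pinMass atTop (𝓝 (1 : ℂ)) := by
  have h1 : Tendsto (fun k : ℕ => (k : ℝ) + 2) atTop atTop :=
    tendsto_atTop_add_const_right _ _ tendsto_natCast_atTop_atTop
  have h2 : Tendsto (fun k : ℕ => ((k : ℝ) + 2)⁻¹) atTop (𝓝 0) := h1.inv_tendsto_atTop
  have h3 : Tendsto (fun k : ℕ => (1 : ℝ) + 1 / ((k : ℝ) + 2)) atTop (𝓝 1) := by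
    have := tendsto_const_nhds (x := (1 : ℝ)) |>.add h2
    simp only [add_zero] at this
    simpa only [one_div] using this
  have h4 := (Complex.continuous_ofReal.tendsto (1 : ℝ)).comp h3
  rw [Complex.ofReal_one] at h4
  exact h4

/-- **Theorems 3.8 (2) / 3.18 (2) combined: thermodynamic-limit states analytic in the mass.**  For the
NJL system (`N ≥ 1`) and every sequence of volumes `Λ_n = (ℤ/L_nℤ)^ν` there is ONE subsequence along
which, for EVERY multi-index `d` simultaneously, the correlation functions `m ↦ ⟨σ^d⟩_{Λ_n}(m)`
converge locally uniformly on `ℂ ∖ i[-√(2ν), √(2ν)] ⊇ 𝒲` to functions holomorphic in the mass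
(diagonal extraction at countably many real masses — the tree's form of Banach–Alaoglu in
`ComplexSpinThermodynamicLimit` — followed by Vitali for each `d`). [cite: SalmhoferSeiler1991, Thm. 3.8 (2) and Thm. 3.18 (2)][cite: GruberKunz1971, §3] -/
theorem exists_subseq_forall_tendstoLocallyUniformlyOn_njlCorrelation {N : ℕ} (hN : 1 ≤ N)
    (Ls : ℕ → ℕ) [∀ n, NeZero (Ls n)] :
    ∃ φ : ℕ → ℕ, StrictMono φ ∧ ∀ d : Site ν →₀ ℕ, ∃ f : ℂ → ℂ,
      DifferentiableOn ℂ f (njlMassRegion ν) ∧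
        TendstoLocallyUniformlyOn (fun n => njlCorrelation N (Ls (φ n)) d) f atTop
          (njlMassRegion ν) := by
  classical
  -- the countably many pinned values, all in the closed unit disc
  set ι := (Site ν →₀ ℕ) × ℕ with hι
  set v : ℕ → ι → ℂ := fun n i => njlCorrelation N (Ls n) i.1 (pinMass i.2) with hv
  set K : Set (ι → ℂ) := Set.pi Set.univ fun _ => closedBall (0 : ℂ) 1 with hK
  have hKc : IsCompact K := isCompact_univ_pi fun _ => isCompact_closedBall _ _
  have hvK : ∀ n, v n ∈ K := by
    intro n
    simp only [hK, Set.mem_pi, Set.mem_univ, forall_true_left, mem_closedBall, dist_zero_right]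
    rintro ⟨d, k⟩
    have hre : (pinMass k).re ≠ 0 := by have := one_le_pinMass_re k; intro h; rw [h] at this; linarith
    have hb := norm_njlExpectC_monomial_le_of_re (ν := ν) (L := Ls n) hN hre
      (Finsupp.mapDomain (Torus.proj (Ls n)) d)
    refine hb.trans (pow_le_one₀ (by positivity) ?_)
    rw [inv_le_one_iff₀]
    right
    have := one_le_pinMass_re k
    rw [abs_of_pos (by linarith)]
    linarith
  obtain ⟨c, -, φ, hφ, hlim⟩ := hKc.isSeqCompact hvK
  refine ⟨φ, hφ, fun d => ?_⟩
  -- Vitali for the multi-index `d`, pinned at the masses `u_k`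
  refine exists_tendstoLocallyUniformlyOn_njlCorrelation_of_tendsto_on hN d (fun n => Ls (φ n))
    (z₀ := 1) (Or.inl (by simp)) (S := Set.range pinMass)
    (Literature.Analysis.Complex.frequently_nhdsNE_of_seq tendsto_pinMass pinMass_ne_one
      fun j => Set.mem_range_self j) ?_
  rintro m ⟨k, rfl⟩
  refine ⟨c (d, k), ?_⟩
  have h := tendsto_pi_nhds.1 hlim (d, k)
  exact h

end ComplexSpin

end Literature.MathematicalPhysics.StatisticalMechanics
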